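import Summits.HubbardSuperconductivity.HubbardSuperconductivity.Theorems.WidthHaldaneColumnPairTriplet
import Summits.HubbardSuperconductivity.HubbardSuperconductivity.Theorems.WidthHaldaneCurrentRigidity

/-!
# Sketch — crux idea `eta-covariant-twist-current` (crux stmt-HubbardSuperconductivity-16311,
`WidthHaldaneBridge`; crux-ideate round 2, ideator k = 4)

First lemmas of the card, TYPED over the landed vocabulary (`Theorems/WidthHaldaneDefs`:
`tubeGraph`, `tubeH0`, `tubeFilling`, `tubeStiffness`; Literature `etaLower`, `creation`,
`annihilation`, `orb`, `expect`, `szSector`, `IsGroundStateInSector`, `Matrix.minEnergyOn`).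
Nothing is proved here (Props only); the card says which landed facts prove each
(`etaLower_commutator_seamPair`, `currentRigidity_of_stiffness`, `minEnergyOn_szSector_add_two_le`,
`etaLower_groundState_eq_zero`).

LEVER. The bond CURRENT is an `η`-vector whose lowered component is the staggered bond SINGLET PAIR
(`[η, i(c†_{xσ}c_{yσ} - h.c.)] = -2i ε_x s_{xy}`, the `α = -β` instance of the landed
`etaLower_commutator_seamPair`; the bond kinetic term `α = β` is an `η`-scalar). Linear extension:
* uniform LONGITUDINAL twist current `J` (the operator UT's stiffness clause couples to, via the
  spread twist `T_θ = (1 - cos(θ/L))·A + sin(θ/L)·J`) ↦ the STAGGERED longitudinal bond-pair field `Π`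
  (`stagLongPair`): `[η, T_θ] = 2i sin(θ/L) Π`;
* staggered `(π,π)` LONGITUDINAL current `J^L_Q = [ρ_Q, H₀]/(2i)` ↦ the UNIFORM extended-`s` bond-pair
  field `Δ_s` (`extSPair`): `[η, J^L_Q] = -2i Δ_s`;
* staggered `(π,π)` TRANSVERSE (d-form-factor) current `K` ↦ the uniform `d_{x²-y²}` pair field
  (landed the other way round: `stub_columnPairTriplet`).
On `η`-lowest-weight ground states (free under UT: `etaLowestWeight`) every CEILING on a current
response becomes, by testing it on `ζ = η†φ`, a NAMED ceiling on a pair amplitude `|⟨φ, Pair ψ⟩|²`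
against the pair-removal form `⟨φ, (H₀ + U - E₀) φ⟩` of the `(N-2)` sector.
-/

noncomputable section

namespace Summit.HubbardSuperconductivity.HubbardSuperconductivity.Cruxes.WidthHaldaneBridge.EtaCovariantTwistCurrent

set_option linter.dupNamespace false

open scoped BigOperators Classical Matrix ComplexConjugate
open Matrix Literature.MathematicalPhysics.QuantumLattice
open Summit.HubbardSuperconductivity.HubbardSuperconductivity.Theorems.WidthHaldane

section Operators

variable (L M : ℕ) [NeZero L] [NeZero M] (Λ : Type) [LinearOrder Λ] [Fintype Λ]
  (e : Λ ≃ ZMod L × ZMod M)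

/-- Total kinetic operator `K = Σ_{x∼y,σ} c†_{xσ} c_{yσ}` (ordered adjacent pairs of `tubeGraph e`;
`tubeH0 = -K + U·D`). [folklore] -/
def kineticOp : Matrix (Finset (Orb Λ)) (Finset (Orb Λ)) ℂ :=
  ∑ x : Λ, ∑ y : Λ, ∑ σ : Fin 2,
    if (tubeGraph e).Adj x y then creation (orb x σ) * annihilation (orb y σ) else 0

/-- Staggered `(π,π)` LONGITUDINAL current `J^L_Q = i Σ_{x∼y,σ} ε_x c†_{xσ} c_{yσ}`
(`= [ρ_Q, H₀]/(2i)`, `ρ_Q = Σ_x ε_x n_x` the staggered density; ordered pairs). [folklore] -/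
def stagLongCurrent (ε : Λ → ℤˣ) : Matrix (Finset (Orb Λ)) (Finset (Orb Λ)) ℂ :=
  Complex.I • ∑ x : Λ, ∑ y : Λ, ∑ σ : Fin 2,
    if (tubeGraph e).Adj x y then ((ε x : ℤ) : ℂ) • (creation (orb x σ) * annihilation (orb y σ)) else 0

/-- Uniform extended-`s` bond-singlet pair field `Δ_s = Σ_{edges {x,y}} (c_{x↑}c_{y↓} - c_{x↓}c_{y↑})`
(half the ordered-pair sum; the singlet annihilator is symmetric in `x ↔ y`). [folklore] -/
def extSPair : Matrix (Finset (Orb Λ)) (Finset (Orb Λ)) ℂ :=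
  (1 / 2 : ℂ) • ∑ x : Λ, ∑ y : Λ,
    if (tubeGraph e).Adj x y then
      (annihilation (orb x 0) * annihilation (orb y 1) - annihilation (orb x 1) * annihilation (orb y 0))
    else 0

/-- Longitudinal kinetic operator `A = Σ_{a,b,σ} (c†_{(a,b)σ} c_{(a-1,b)σ} + h.c.)` (its expectation is
the `K(ψ)` of `WidthHaldaneTubeLandauForm`). [folklore] -/
def longKineticOp : Matrix (Finset (Orb Λ)) (Finset (Orb Λ)) ℂ :=
  ∑ a : ZMod L, ∑ b : ZMod M, ∑ σ : Fin 2,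
    (creation (orb (e.symm (a, b)) σ) * annihilation (orb (e.symm (a - 1, b)) σ) +
      creation (orb (e.symm (a - 1, b)) σ) * annihilation (orb (e.symm (a, b)) σ))

/-- Staggered LONGITUDINAL bond-singlet pair field
`Π = Σ_{a,b} ε_{(a,b)} (c_{(a,b)↑} c_{(a-1,b)↓} - c_{(a,b)↓} c_{(a-1,b)↑})` — the `η`-lowered partner of
the uniform longitudinal current (`[η, T_θ] = 2i sin(θ/L) Π` for the spread twist `T_θ`).
[folklore] -/
def stagLongPair (ε : Λ → ℤˣ) : Matrix (Finset (Orb Λ)) (Finset (Orb Λ)) ℂ :=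
  ∑ a : ZMod L, ∑ b : ZMod M, ((ε (e.symm (a, b)) : ℤ) : ℂ) •
    (annihilation (orb (e.symm (a, b)) 0) * annihilation (orb (e.symm (a - 1, b)) 1) -
      annihilation (orb (e.symm (a, b)) 1) * annihilation (orb (e.symm (a - 1, b)) 0))

end Operators

/-! ### First lemma 1 — f-sum PINNING of the longitudinal staggered current (UT-free, any `U`)

For every sector ground state `ψ` (energy `E₀`) and EVERY `ζ` in the same sector:
`2Re⟨ζ, J^L_Q ψ⟩ - Re⟨ζ, (H₀ - E₀) ζ⟩ ≤ ½ K(ψ)`, i.e. the static susceptibility of `ψ` to the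
longitudinal `(π,π)` current is AT MOST (in fact exactly) half the kinetic energy: the lattice
continuity equation `[ρ_Q, H₀] = 2i J^L_Q` and the double commutator `[ρ_Q, [ρ_Q, H₀]] = 4 H_hop`
(Cauchy–Schwarz in the PSD form `H₀ - E₀` on the sector). -/

/-- **FL1 (f-sum pinning at `Q = (π,π)`)**. [folklore] -/
def FsumPinning : Prop :=
  ∀ (L M : ℕ) [NeZero L] [NeZero M] (Λ : Type) [LinearOrder Λ] [Fintype Λ]
    (e : Λ ≃ ZMod L × ZMod M) (ε : Λ → ℤˣ), (∀ x y, (tubeGraph e).Adj x y → ε x = -ε y) →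
    ∀ (U : ℝ) (N : ℕ) (ψ ζ : Fock (Orb Λ)), star ψ ⬝ᵥ ψ = 1 →
      IsGroundStateInSector (tubeH0 L M Λ e U) N 0 ψ → ζ ∈ szSector N (0 : ℝ) →
        2 * (star ζ ⬝ᵥ (stagLongCurrent L M Λ e ε *ᵥ ψ)).re -
            ((star ζ ⬝ᵥ (tubeH0 L M Λ e U *ᵥ ζ)).re -
              (tubeH0 L M Λ e U).minEnergyOn (szSector N 0) * (star ζ ⬝ᵥ ζ).re) ≤
          (1 / 2) * (expect (kineticOp L M Λ e) ψ).re

/-! ### First lemma 2 — the extended-`s` CEILING (UT-free): `η`-covariance turns FL1 into a named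
pair ceiling. For an `η`-lowest-weight unit ground state `ψ` of the `(N, S^z=0)` sector and every `φ`
of the `(N-2, S^z=0)` sector:
`|⟨φ, Δ_s ψ⟩|² ≤ ¼ (j₀+1) K(ψ) · Re⟨φ, (H₀ + U - E₀) φ⟩`, `j₀ + 1 = (|Λ| - N)/2 + 1`
(test FL1 on `ζ = t η†φ`: `⟨η†φ, J^L ψ⟩ = ⟨φ, [η, J^L] ψ⟩ = -2i⟨φ, Δ_s ψ⟩`,
`⟨η†φ, (H₀ - E₀) η†φ⟩ = 2(j₀+1)⟨φ, (H₀ + U - E₀)φ⟩` on lowest-weight `φ`, projection for general `φ`).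
With `φ` the `(N-2)` ground state: the extended-`s` TOWER OVERLAP is at most `¼(j₀+1)K(ψ)Δ_η`,
`Δ_η = E₀(N-2) + U - E₀(N)` — a rigorous, `L`-uniform ceiling on the `A₁g` competitor channel. -/

/-- **FL2 (extended-`s` tower ceiling)**. [folklore] -/
def ExtSCeiling : Prop :=
  ∀ (L M : ℕ) [NeZero L] [NeZero M] (Λ : Type) [LinearOrder Λ] [Fintype Λ]
    (e : Λ ≃ ZMod L × ZMod M) (ε : Λ → ℤˣ), (∀ x y, (tubeGraph e).Adj x y → ε x = -ε y) →
    ∀ (U : ℝ) (N : ℕ), 2 ≤ N → ∀ (ψ φ : Fock (Orb Λ)), star ψ ⬝ᵥ ψ = 1 →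
      IsGroundStateInSector (tubeH0 L M Λ e U) N 0 ψ → etaLower ε *ᵥ ψ = 0 →
      φ ∈ szSector (N - 2) (0 : ℝ) →
        ‖star φ ⬝ᵥ (extSPair L M Λ e *ᵥ ψ)‖ ^ 2 ≤
          (1 / 4) * (((Fintype.card Λ : ℝ) - N) / 2 + 1) * (expect (kineticOp L M Λ e) ψ).re *
            (star φ ⬝ᵥ ((tubeH0 L M Λ e U +
              ((U - (tubeH0 L M Λ e U).minEnergyOn (szSector N 0) : ℝ) : ℂ) • (1 : Matrix _ _ ℂ)) *ᵥ φ)).re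

/-! ### First lemma 3 — the stiffness clause of UT as a NAMED two-body ceiling (the card's
"why it bites here"). Testing the landed current rigidity (`currentRigidity_of_stiffness`:
`H₀ + T_{π/3} ≥ E₀ + c` on the sector, `c = d₀(π/3)²M/(2L)`) on `ζ = t η†φ` and using
`[η, T_θ] = 2i sin(θ/L) Π` gives, for REAL lowest-weight `ψ`, `φ` (the pure tube is a real
symmetric matrix, so real ground vectors span every ground space):
`|⟨φ, Π ψ⟩|² ≤ [((1-cos(π/3L)) K_x(ψ) - c) / (2 sin²(π/3L))] · (j₀+1) ·
               [Re⟨φ,(H₀+U-E₀)φ⟩ + (1-cos(π/3L))·2LM‖φ‖²]`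
— the kinetic budget of the STAGGERED longitudinal bond-pair channel is `½(K_x(ψ) - d₀LM)(1+o(1))`
instead of `½K_x(ψ)`: UT's stiffness floor subtracts the superfluid weight from a competitor pair
channel. (A ceiling, Drude-type, channel `(π,π)`: the card states what this does and does not buy.) -/

/-- **FL3 (staggered longitudinal pair ceiling from the stiffness floor)**. [folklore] -/
def StagPairCeilingOfStiffness : Prop :=
  ∀ (L M : ℕ) [NeZero L] [NeZero M] (Λ : Type) [LinearOrder Λ] [Fintype Λ]
    (e : Λ ≃ ZMod L × ZMod M), 3 ≤ L → ∀ (ε : Λ → ℤˣ), (∀ x y, (tubeGraph e).Adj x y → ε x = -ε y) →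
    ∀ (U δ d₀ : ℝ), d₀ ≤ tubeStiffness L M Λ e U δ → 2 ≤ tubeFilling L M δ →
    ∀ (ψ φ : Fock (Orb Λ)), star ψ ⬝ᵥ ψ = 1 →
      IsGroundStateInSector (tubeH0 L M Λ e U) (tubeFilling L M δ) 0 ψ → etaLower ε *ᵥ ψ = 0 →
      (∀ i, (ψ i).im = 0) → φ ∈ szSector (tubeFilling L M δ - 2) (0 : ℝ) → etaLower ε *ᵥ φ = 0 →
      (∀ i, (φ i).im = 0) →
        ‖star φ ⬝ᵥ (stagLongPair L M Λ e ε *ᵥ ψ)‖ ^ 2 ≤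
          (((1 - Real.cos (Real.pi / 3 / L)) * (expect (longKineticOp L M Λ e) ψ).re -
                d₀ * (Real.pi / 3) ^ 2 * (M : ℝ) / (2 * (L : ℝ))) /
              (2 * Real.sin (Real.pi / 3 / L) ^ 2)) *
            (((Fintype.card Λ : ℝ) - tubeFilling L M δ) / 2 + 1) *
            ((star φ ⬝ᵥ ((tubeH0 L M Λ e U +
                ((U - (tubeH0 L M Λ e U).minEnergyOn (szSector (tubeFilling L M δ) 0) : ℝ) : ℂ) •
                  (1 : Matrix _ _ ℂ)) *ᵥ φ)).re +
              (1 - Real.cos (Real.pi / 3 / L)) * 2 * (L : ℝ) * (M : ℝ) * (star φ ⬝ᵥ φ).re)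

/-! ### The structural statement the card rests on (recorded as a Prop, not claimed provable here):
`[η, T_θ] = 2i sin(θ/L) Π` for the spread twist of `WidthHaldaneCurrentRigidity` — linear extension of
the landed `etaLower_commutator_seamPair` over the longitudinal bonds (`L ≥ 3`). -/

/-- **The twist is an `η`-vector.** [folklore] -/
def TwistEtaVector : Prop :=
  ∀ (L M : ℕ) [NeZero L] [NeZero M] (Λ : Type) [LinearOrder Λ] [Fintype Λ]
    (e : Λ ≃ ZMod L × ZMod M), 3 ≤ L → ∀ (ε : Λ → ℤˣ), (∀ x y, (tubeGraph e).Adj x y → ε x = -ε y) →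
    ∀ θ : ℝ,
      etaLower ε * (∑ x : Λ, ∑ y : Λ, ∑ σ : Fin 2, (if (tubeGraph e).Adj x y then
          (1 - (if (e x).1 = (e y).1 + 1 ∧ (e x).2 = (e y).2 then Complex.exp (((θ / L : ℝ) : ℂ) * Complex.I)
            else if (e y).1 = (e x).1 + 1 ∧ (e x).2 = (e y).2 then Complex.exp (-(((θ / L : ℝ) : ℂ) * Complex.I))
            else 1)) • (creation (orb x σ) * annihilation (orb y σ)) else 0)) -
        (∑ x : Λ, ∑ y : Λ, ∑ σ : Fin 2, (if (tubeGraph e).Adj x y then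
          (1 - (if (e x).1 = (e y).1 + 1 ∧ (e x).2 = (e y).2 then Complex.exp (((θ / L : ℝ) : ℂ) * Complex.I)
            else if (e y).1 = (e x).1 + 1 ∧ (e x).2 = (e y).2 then Complex.exp (-(((θ / L : ℝ) : ℂ) * Complex.I))
            else 1)) • (creation (orb x σ) * annihilation (orb y σ)) else 0)) * etaLower ε =
        (2 * Complex.I * (Real.sin (θ / L) : ℂ)) • stagLongPair L M Λ e ε

end Summit.HubbardSuperconductivity.HubbardSuperconductivity.Cruxes.WidthHaldaneBridge.EtaCovariantTwistCurrent

end
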